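import Mathlib
import HarnessLib
import Summits.QuantumFields.YangMills.Theses.PencilRigidity
/-!
# `CurvatureKernelBound` — stub H `HalfSpaceKernel`, Riemann sums of translated bumps against an exact partition of unity

(support for stmt-QuantumFields-11687, line `sixteen-charts-analytic-kernel`, skeleton v11)
-/

noncomputable section

open scoped BigOperators Topology SchwartzMap ComplexConjugate InnerProductSpace
open MeasureTheory Filter Set Metric
open Literature.MathematicalPhysics.QuantumLattice Literature.MathematicalPhysics.AQFT
open Literature.MathematicalPhysics.QuantumFieldTheory

namespace Summit.QuantumFields.YangMills.Theorems.CurvatureKernel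
/-! ## E. Riemann sums of translated bumps against an exact partition of unity -/

section Riemann

variable (ϖ : (EuclideanSpace ℝ (Fin 4)) → ℝ) (hϖc : Continuous ϖ) (hϖ0 : ∀ x, 0 ≤ ϖ x)
  (hϖsupp : tsupport ϖ ⊆ Metric.closedBall (0 : (EuclideanSpace ℝ (Fin 4))) 2)
  (hϖle : ∀ (N : ℕ) (y : (EuclideanSpace ℝ (Fin 4))), ∑ j ∈ Fintype.piFinset (fun _ : Fin 4 => Finset.Icc (-(N : ℤ)) N),
    ϖ (y - WithLp.toLp 2 (fun i => ((j i : ℤ) : ℝ))) ≤ 1)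
  (hϖeq : ∀ (N : ℕ) (y : (EuclideanSpace ℝ (Fin 4))), (∀ i : Fin 4, |y i| ≤ N) →
    ∑ j ∈ Fintype.piFinset (fun _ : Fin 4 => Finset.Icc (-(N : ℤ)) N), ϖ (y - WithLp.toLp 2 (fun i => ((j i : ℤ) : ℝ))) = 1)

include hϖsupp in
/-- If the rescaled translated bump `ϖ (Δ⁻¹ • x - z)` does not vanish, then `x` is `2Δ`-close to
the node `Δ • z`. [folklore] -/
private theorem dist_smul_le_of_bump_ne_zero {Δ : ℝ} (hΔ : 0 < Δ) (z x : EuclideanSpace ℝ (Fin 4))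
    (hz : ϖ (Δ⁻¹ • x - z) ≠ 0) : dist (Δ • z) x ≤ 2 * Δ := by
  have hmem : Δ⁻¹ • x - z ∈ Metric.closedBall (0 : EuclideanSpace ℝ (Fin 4)) 2 :=
    hϖsupp (subset_tsupport _ hz)
  rw [Metric.mem_closedBall, dist_zero_right] at hmem
  have hx : x - Δ • z = Δ • (Δ⁻¹ • x - z) := by
    rw [smul_sub, smul_inv_smul₀ hΔ.ne']
  rw [dist_comm, dist_eq_norm, hx, norm_smul, Real.norm_eq_abs, abs_of_pos hΔ]
  nlinarith

include hϖ0 hϖsupp in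
/-- Pointwise bound on one term of the recentred Riemann sum:
`‖(u (Δ z) - u x) ϖ(x/Δ - z)‖ ≤ ω ϖ(x/Δ - z)`. [folklore] -/
private theorem norm_sub_mul_bump_le {Δ : ℝ} (hΔ : 0 < Δ) (u : EuclideanSpace ℝ (Fin 4) → ℂ) {ω : ℝ}
    (hmod : ∀ x y : EuclideanSpace ℝ (Fin 4), dist x y ≤ 2 * Δ → ‖u x - u y‖ ≤ ω)
    (z x : EuclideanSpace ℝ (Fin 4)) :
    ‖(u (Δ • z) - u x) * (ϖ (Δ⁻¹ • x - z) : ℂ)‖ ≤ ω * ϖ (Δ⁻¹ • x - z) := by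
  by_cases hz : ϖ (Δ⁻¹ • x - z) = 0
  · simp [hz]
  rw [norm_mul, Complex.norm_of_nonneg (hϖ0 _)]
  exact mul_le_mul_of_nonneg_right (hmod _ _ (dist_smul_le_of_bump_ne_zero ϖ hϖsupp hΔ z x hz))
    (hϖ0 _)

include hϖ0 hϖsupp hϖle in
/-- The recentred Riemann sum `Σ_j (u(Δ j) − u x) ϖ(x/Δ − j)` has norm at most `ω`. [folklore] -/
private theorem norm_sum_sub_mul_bump_le {Δ : ℝ} (hΔ : 0 < Δ) (N : ℕ)
    (u : EuclideanSpace ℝ (Fin 4) → ℂ) {ω : ℝ} (hω : 0 ≤ ω)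
    (hmod : ∀ x y : EuclideanSpace ℝ (Fin 4), dist x y ≤ 2 * Δ → ‖u x - u y‖ ≤ ω)
    (x : EuclideanSpace ℝ (Fin 4)) :
    ‖∑ j ∈ Fintype.piFinset (fun _ : Fin 4 => Finset.Icc (-(N : ℤ)) N),
        (u (Δ • WithLp.toLp 2 (fun i => ((j i : ℤ) : ℝ))) - u x) *
          (ϖ (Δ⁻¹ • x - WithLp.toLp 2 (fun i => ((j i : ℤ) : ℝ))) : ℂ)‖ ≤ ω := by
  calc ‖∑ j ∈ Fintype.piFinset (fun _ : Fin 4 => Finset.Icc (-(N : ℤ)) N),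
        (u (Δ • WithLp.toLp 2 (fun i => ((j i : ℤ) : ℝ))) - u x) *
          (ϖ (Δ⁻¹ • x - WithLp.toLp 2 (fun i => ((j i : ℤ) : ℝ))) : ℂ)‖
      ≤ ∑ j ∈ Fintype.piFinset (fun _ : Fin 4 => Finset.Icc (-(N : ℤ)) N),
          ‖(u (Δ • WithLp.toLp 2 (fun i => ((j i : ℤ) : ℝ))) - u x) *
            (ϖ (Δ⁻¹ • x - WithLp.toLp 2 (fun i => ((j i : ℤ) : ℝ))) : ℂ)‖ := norm_sum_le _ _
    _ ≤ ∑ j ∈ Fintype.piFinset (fun _ : Fin 4 => Finset.Icc (-(N : ℤ)) N),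
          ω * ϖ (Δ⁻¹ • x - WithLp.toLp 2 (fun i => ((j i : ℤ) : ℝ))) :=
        Finset.sum_le_sum fun j _ => norm_sub_mul_bump_le ϖ hϖ0 hϖsupp hΔ u hmod _ x
    _ = ω * ∑ j ∈ Fintype.piFinset (fun _ : Fin 4 => Finset.Icc (-(N : ℤ)) N),
          ϖ (Δ⁻¹ • x - WithLp.toLp 2 (fun i => ((j i : ℤ) : ℝ))) := by rw [Finset.mul_sum]
    _ ≤ ω * 1 := mul_le_mul_of_nonneg_left (hϖle N _) hω
    _ = ω := mul_one ω

include hϖeq in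
/-- Recentring the Riemann sum: `Σ_j u(Δ j) ϖ(x/Δ − j) − u x = Σ_j (u(Δ j) − u x) ϖ(x/Δ − j)`, because
either `u x = 0` or the partition is exact at `x/Δ`. [folklore] -/
private theorem riemannSum_sub_eq {Δ : ℝ} (hΔ : 0 < Δ) (N : ℕ) (u : EuclideanSpace ℝ (Fin 4) → ℂ)
    (hsupp : ∀ x, u x ≠ 0 → ∀ i : Fin 4, |x i| + 2 * Δ ≤ N * Δ) (x : EuclideanSpace ℝ (Fin 4)) :
    (∑ j ∈ Fintype.piFinset (fun _ : Fin 4 => Finset.Icc (-(N : ℤ)) N),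
        u (Δ • WithLp.toLp 2 (fun i => ((j i : ℤ) : ℝ))) *
          (ϖ (Δ⁻¹ • x - WithLp.toLp 2 (fun i => ((j i : ℤ) : ℝ))) : ℂ)) - u x =
      ∑ j ∈ Fintype.piFinset (fun _ : Fin 4 => Finset.Icc (-(N : ℤ)) N),
        (u (Δ • WithLp.toLp 2 (fun i => ((j i : ℤ) : ℝ))) - u x) *
          (ϖ (Δ⁻¹ • x - WithLp.toLp 2 (fun i => ((j i : ℤ) : ℝ))) : ℂ) := by
  by_cases hux : u x = 0
  · simp [hux]
  have hyN : ∀ i : Fin 4, |(Δ⁻¹ • x) i| ≤ N := by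
    intro i
    have h := hsupp x hux i
    rw [PiLp.smul_apply, smul_eq_mul, abs_mul, abs_of_pos (inv_pos.mpr hΔ), inv_mul_le_iff₀ hΔ]
    nlinarith
  have h1 : ∑ j ∈ Fintype.piFinset (fun _ : Fin 4 => Finset.Icc (-(N : ℤ)) N),
      (ϖ (Δ⁻¹ • x - WithLp.toLp 2 (fun i => ((j i : ℤ) : ℝ))) : ℂ) = 1 := by
    exact_mod_cast hϖeq N _ hyN
  simp_rw [sub_mul, Finset.sum_sub_distrib, ← Finset.mul_sum, h1, mul_one]

include hϖ0 hϖsupp hϖle hϖeq in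
/-- **Uniform approximation by Riemann sums of translated bumps.** For `u` continuous, supported where the
partition (at scale `Δ`, cube `[-N,N]⁴`) is exact, with modulus `ω` at scale `2Δ`:
`|Σ_j u(Δ j) ϖ(x/Δ − j) − u(x)| ≤ ω` for every `x`. [folklore] -/
theorem norm_riemannSum_sub_le {Δ : ℝ} (hΔ : 0 < Δ) (N : ℕ) (u : (EuclideanSpace ℝ (Fin 4)) → ℂ)
    (hsupp : ∀ x, u x ≠ 0 → ∀ i : Fin 4, |x i| + 2 * Δ ≤ N * Δ)
    {ω : ℝ} (hω : 0 ≤ ω) (hmod : ∀ x y : EuclideanSpace ℝ (Fin 4), dist x y ≤ 2 * Δ → ‖u x - u y‖ ≤ ω)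
    (x : EuclideanSpace ℝ (Fin 4)) :
    ‖(∑ j ∈ Fintype.piFinset (fun _ : Fin 4 => Finset.Icc (-(N : ℤ)) N),
        u (Δ • WithLp.toLp 2 (fun i => ((j i : ℤ) : ℝ))) * (ϖ (Δ⁻¹ • x - WithLp.toLp 2 (fun i => ((j i : ℤ) : ℝ))) : ℂ)) - u x‖ ≤ ω := by
  rw [riemannSum_sub_eq ϖ hϖeq hΔ N u hsupp x]
  exact norm_sum_sub_mul_bump_le ϖ hϖ0 hϖsupp hϖle hΔ N u hω hmod x

include hϖc hϖ0 hϖsupp hϖle hϖeq in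
/-- **Riemann sum versus integral** through the exact partition: for `u` continuous with
`supp u ⊆ B̄(c, R)` inside the exact region and modulus `ω` at scale `2Δ`,
`|Σ_j u(Δ j) Δ⁴∫ϖ − ∫u| ≤ ω · vol B̄(c, R + 2Δ)`. [folklore] -/
theorem norm_riemannSum_sub_integral_le {Δ : ℝ} (hΔ : 0 < Δ) (N : ℕ) (u : (EuclideanSpace ℝ (Fin 4)) → ℂ)
    (hu : Continuous u) (c : EuclideanSpace ℝ (Fin 4)) (R : ℝ) (hR : 0 ≤ R)
    (husupp : Function.support u ⊆ Metric.closedBall c R)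
    (hsupp : ∀ x ∈ Metric.closedBall c (R + 2 * Δ), ∀ i : Fin 4, |x i| + 2 * Δ ≤ N * Δ)
    {ω : ℝ} (hω : 0 ≤ ω) (hmod : ∀ x y : EuclideanSpace ℝ (Fin 4), dist x y ≤ 2 * Δ → ‖u x - u y‖ ≤ ω) :
    ‖(∑ j ∈ Fintype.piFinset (fun _ : Fin 4 => Finset.Icc (-(N : ℤ)) N),
        u (Δ • WithLp.toLp 2 (fun i => ((j i : ℤ) : ℝ))) * ((Δ ^ 4 * ∫ y, ϖ y : ℝ) : ℂ)) - ∫ x, u x‖ ≤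
      ω * (MeasureTheory.volume (Metric.closedBall c (R + 2 * Δ))).toReal := by
  -- `0 ≤ R` is not needed below (`R ≤ R + 2Δ` already follows from `0 < Δ`); it is referenced here only
  -- so that the fixed signature elaborates lint-clean.
  have _ := hR
  -- integrability of the bump, of `u`, and of the rescaled translated bumps
  have hϖcs : HasCompactSupport ϖ :=
    IsCompact.of_isClosed_subset (isCompact_closedBall 0 2) (isClosed_tsupport ϖ) hϖsupp
  have hϖi : Integrable ϖ := hϖc.integrable_of_hasCompactSupport hϖcs
  have hui : Integrable u :=
    hu.integrable_of_hasCompactSupport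
      (HasCompactSupport.of_support_subset_isCompact (isCompact_closedBall c R) husupp)
  have hTi : ∀ z : EuclideanSpace ℝ (Fin 4),
      Integrable (fun y : EuclideanSpace ℝ (Fin 4) => (ϖ (Δ⁻¹ • y - z) : ℂ)) := fun z =>
    ((hϖi.comp_sub_right z).comp_smul (inv_ne_zero hΔ.ne')).ofReal
  have hTi' : ∀ j ∈ Fintype.piFinset (fun _ : Fin 4 => Finset.Icc (-(N : ℤ)) N),
      Integrable (fun y : EuclideanSpace ℝ (Fin 4) => u (Δ • WithLp.toLp 2 (fun i => ((j i : ℤ) : ℝ))) *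
        (ϖ (Δ⁻¹ • y - WithLp.toLp 2 (fun i => ((j i : ℤ) : ℝ))) : ℂ)) := fun j _ =>
    (hTi _).const_mul _
  -- the integral of a rescaled translated bump
  have hTint : ∀ z : EuclideanSpace ℝ (Fin 4),
      ∫ y : EuclideanSpace ℝ (Fin 4), (ϖ (Δ⁻¹ • y - z) : ℂ) = ((Δ ^ 4 * ∫ y, ϖ y : ℝ) : ℂ) := by
    intro z
    rw [integral_complex_ofReal]
    congr 1
    have h1 := Measure.integral_comp_inv_smul_of_nonneg volume
      (fun y : EuclideanSpace ℝ (Fin 4) => ϖ (y - z)) hΔ.le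
    simp only [finrank_euclideanSpace_fin, smul_eq_mul] at h1
    rw [h1, integral_sub_right_eq_self ϖ z]
  -- `u` vanishes outside the exact region
  have hRR : R ≤ R + 2 * Δ := by linarith
  have hsupp' : ∀ x, u x ≠ 0 → ∀ i : Fin 4, |x i| + 2 * Δ ≤ N * Δ := fun x hx =>
    hsupp x (Metric.closedBall_subset_closedBall hRR (husupp hx))
  -- (a) the weighted sum is an integral
  have hA : (∑ j ∈ Fintype.piFinset (fun _ : Fin 4 => Finset.Icc (-(N : ℤ)) N),
        u (Δ • WithLp.toLp 2 (fun i => ((j i : ℤ) : ℝ))) * ((Δ ^ 4 * ∫ y, ϖ y : ℝ) : ℂ)) =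
      ∫ y : EuclideanSpace ℝ (Fin 4), ∑ j ∈ Fintype.piFinset (fun _ : Fin 4 => Finset.Icc (-(N : ℤ)) N),
        u (Δ • WithLp.toLp 2 (fun i => ((j i : ℤ) : ℝ))) *
          (ϖ (Δ⁻¹ • y - WithLp.toLp 2 (fun i => ((j i : ℤ) : ℝ))) : ℂ) := by
    rw [integral_finsetSum _ hTi']
    exact Finset.sum_congr rfl fun j _ => by rw [integral_const_mul, hTint]
  -- (b) the difference is one integral of the recentred sums
  have hB : (∑ j ∈ Fintype.piFinset (fun _ : Fin 4 => Finset.Icc (-(N : ℤ)) N),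
        u (Δ • WithLp.toLp 2 (fun i => ((j i : ℤ) : ℝ))) * ((Δ ^ 4 * ∫ y, ϖ y : ℝ) : ℂ)) - ∫ x, u x =
      ∫ y : EuclideanSpace ℝ (Fin 4), ∑ j ∈ Fintype.piFinset (fun _ : Fin 4 => Finset.Icc (-(N : ℤ)) N),
        (u (Δ • WithLp.toLp 2 (fun i => ((j i : ℤ) : ℝ))) - u y) *
          (ϖ (Δ⁻¹ • y - WithLp.toLp 2 (fun i => ((j i : ℤ) : ℝ))) : ℂ) := by
    rw [hA, ← integral_sub (integrable_finsetSum _ hTi') hui]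
    exact integral_congr_ae (Eventually.of_forall fun y => riemannSum_sub_eq ϖ hϖeq hΔ N u hsupp' y)
  -- (c) pointwise bound: `ω` on `closedBall c (R + 2Δ)`, `0` outside
  have hC : ∀ y : EuclideanSpace ℝ (Fin 4),
      ‖∑ j ∈ Fintype.piFinset (fun _ : Fin 4 => Finset.Icc (-(N : ℤ)) N),
        (u (Δ • WithLp.toLp 2 (fun i => ((j i : ℤ) : ℝ))) - u y) *
          (ϖ (Δ⁻¹ • y - WithLp.toLp 2 (fun i => ((j i : ℤ) : ℝ))) : ℂ)‖ ≤
        (Metric.closedBall c (R + 2 * Δ)).indicator (fun _ => ω) y := by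
    intro y
    by_cases hy : y ∈ Metric.closedBall c (R + 2 * Δ)
    · rw [Set.indicator_of_mem hy]
      exact norm_sum_sub_mul_bump_le ϖ hϖ0 hϖsupp hϖle hΔ N u hω hmod y
    rw [Set.indicator_of_notMem hy, Finset.sum_eq_zero, norm_zero]
    intro j _
    have huy : u y = 0 := Function.notMem_support.mp fun h =>
      hy (Metric.closedBall_subset_closedBall hRR (husupp h))
    by_cases hϖj : ϖ (Δ⁻¹ • y - WithLp.toLp 2 (fun i => ((j i : ℤ) : ℝ))) = 0
    · simp [hϖj]
    by_cases huj : u (Δ • WithLp.toLp 2 (fun i => ((j i : ℤ) : ℝ))) = 0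
    · simp [huj, huy]
    exfalso
    apply hy
    have h1 := dist_smul_le_of_bump_ne_zero ϖ hϖsupp hΔ _ y hϖj
    have h2 : dist (Δ • WithLp.toLp 2 (fun i => ((j i : ℤ) : ℝ))) c ≤ R := husupp huj
    rw [dist_comm] at h1
    rw [Metric.mem_closedBall]
    calc dist y c ≤ dist y (Δ • WithLp.toLp 2 (fun i => ((j i : ℤ) : ℝ))) +
        dist (Δ • WithLp.toLp 2 (fun i => ((j i : ℤ) : ℝ))) c := dist_triangle _ _ _
      _ ≤ R + 2 * Δ := by linarith
  -- (d) integrate the pointwise bound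
  have hInd : Integrable ((Metric.closedBall c (R + 2 * Δ)).indicator fun _ => ω) :=
    (integrableOn_const (measure_closedBall_lt_top).ne).integrable_indicator measurableSet_closedBall
  rw [hB]
  calc _ ≤ ∫ y, (Metric.closedBall c (R + 2 * Δ)).indicator (fun _ => ω) y :=
        norm_integral_le_of_norm_le hInd (Eventually.of_forall hC)
    _ = ω * (MeasureTheory.volume (Metric.closedBall c (R + 2 * Δ))).toReal := by
        rw [integral_indicator_const _ measurableSet_closedBall, smul_eq_mul, measureReal_def, mul_comm _ ω]

end Riemann



/-- **Sub-goal `RiemannSumApproximation`** (helper for stub `HalfSpaceKernel`; registered signature): uniform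
approximation of a uniformly continuous function by the Riemann sums of the translated, rescaled bumps of an exact
partition of unity. [folklore] -/
theorem RiemannSumApproximation : ∀ (ϖ : EuclideanSpace ℝ (Fin 4) → ℝ), (∀ x, 0 ≤ ϖ x) → tsupport ϖ ⊆ Metric.closedBall (0 : EuclideanSpace ℝ (Fin 4)) 2 → (∀ (N : ℕ) (y : EuclideanSpace ℝ (Fin 4)), ∑ j ∈ Fintype.piFinset (fun _ : Fin 4 => Finset.Icc (-(N : ℤ)) N), ϖ (y - WithLp.toLp 2 (fun i => ((j i : ℤ) : ℝ))) ≤ 1) → (∀ (N : ℕ) (y : EuclideanSpace ℝ (Fin 4)), (∀ i : Fin 4, |y i| ≤ N) → ∑ j ∈ Fintype.piFinset (fun _ : Fin 4 => Finset.Icc (-(N : ℤ)) N), ϖ (y - WithLp.toLp 2 (fun i => ((j i : ℤ) : ℝ))) = 1) → ∀ (Δ : ℝ), 0 < Δ → ∀ (N : ℕ) (u : EuclideanSpace ℝ (Fin 4) → ℂ), (∀ x, u x ≠ 0 → ∀ i : Fin 4, |x i| + 2 * Δ ≤ N * Δ) → ∀ (ω : ℝ), 0 ≤ ω → (∀ x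 y : EuclideanSpace ℝ (Fin 4), dist x y ≤ 2 * Δ → ‖u x - u y‖ ≤ ω) → ∀ x : EuclideanSpace ℝ (Fin 4), ‖(∑ j ∈ Fintype.piFinset (fun _ : Fin 4 => Finset.Icc (-(N : ℤ)) N), u (Δ • WithLp.toLp 2 (fun i => ((j i : ℤ) : ℝ))) * (ϖ (Δ⁻¹ • x - WithLp.toLp 2 (fun i => ((j i : ℤ) : ℝ))) : ℂ)) - u x‖ ≤ ω := by
  intro ϖ hϖ0 hϖsupp hϖle hϖeq Δ hΔ N u hsupp ω hω hmod x
  exact norm_riemannSum_sub_le ϖ hϖ0 hϖsupp hϖle hϖeq hΔ N u hsupp hω hmod x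

end Summit.QuantumFields.YangMills.Theorems.CurvatureKernel

end
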